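import Mathlib.Analysis.SpecialFunctions.Integrals.Basic
import Mathlib.MeasureTheory.Integral.IntervalIntegral.IntegrationByParts
import Mathlib.Analysis.Calculus.ContDiff.Deriv
import HarnessLib

/-!
# One-dimensional identities behind the second multiplier of the polar model operator
([Elgindi2021] §7.1, Proposition 7.1 Step 2, "multiply by `−∂_θθΨ`")

Topic `Literature/Analysis/FluidPDE`. Proof file (everything proved, no definitions, no named
facts) on the proof path of the named fact
`Literature.Analysis.FluidPDE.Elgindi.ElgindiGhoulMasmoudi2021_stabilityCore`
(`ElgindiStabilityDecomposition.lean`). T. M. Elgindi, Ann. of Math. 194 (2021) =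
arXiv:1904.04795, §7.1 proof of Proposition 7.1, Step 2 (pp. 19–20):

> "Now we come back to equation (PolarBSL) and multiply by `−∂_θθΨ` and integrate. Integrating by
> parts in `R` and `θ` we get: `α²|R∂_{Rθ}Ψ|² − α²|∂_θΨ|² + (α(5+α)/2)|∂_θΨ|² + |∂_θθΨ|² − 6|∂_θΨ|²
> − ∫∂_θ(tan(θ)Ψ)∂_θθΨ = ∫F∂_θθΨ.` … First let `Ψ̃ = Ψ/cos(θ)` …
> `−∫∂_θ(tanθΨ)∂_θθΨ = … = (3/2)∫(∂_θΨ̃)² + G` where `|G| ≤ (3/2)|Ψ̃|²`".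

The two angular identities this rests on, for the a-priori class `Ψ = cosθ·χ` (`χ = Ψ̃`):
* `∫₀^{π/2}w u″ = −∫₀^{π/2}w′u′` for `w(0) = w(π/2) = 0` (`integral_mul_deriv2_dirichlet`), used with
  `w` a radial derivative of `Ψ` and `u = Ψ`;
* the `tan`-multiplier identity in closed form (sharper than the printed `G`-bound: `G = ½∫χ²` exactly):
  `∫₀^{π/2}(cosθχ + sinθχ′)(cosθχ + 2sinθχ′ − cosθχ″)dθ = (3/2)∫₀^{π/2}χ′² + ½∫₀^{π/2}χ²` for
  `χ ∈ C²`, `χ(0) = 0` (`integral_tanTerm_mul_deriv2`; note `−∂_θθ(cosθχ) = cosθχ + 2sinθχ′ − cosθχ″`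
  and `∂_θ(tanθ·cosθχ) = cosθχ + sinθχ′`), via the antiderivative
  `½sinθcosθχ² − cos²θχχ′ − ½sinθcosθχ′²`.
-/

noncomputable section

open MeasureTheory Set Real intervalIntegral

namespace Literature.Analysis.FluidPDE

namespace Elgindi

/-- `∫₀^{π/2}w u″ = −∫₀^{π/2}w′u′` for `w ∈ C¹` vanishing at both ends and `u ∈ C²`. [cite: Elgindi2021, §7.1 proof of Proposition 7.1 Step 2 ("Integrating by parts in R and θ") (p. 19 of arXiv:1904.04795)] -/
theorem integral_mul_deriv2_dirichlet {w u : ℝ → ℝ} (hw : ContDiff ℝ 1 w) (hu : ContDiff ℝ 2 u)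
    (hw0 : w 0 = 0) (hw1 : w (π / 2) = 0) :
    ∫ θ in (0 : ℝ)..(π / 2), w θ * deriv (deriv u) θ = -∫ θ in (0 : ℝ)..(π / 2), deriv w θ * deriv u θ := by
  have hdw : Differentiable ℝ w := hw.differentiable (by simp)
  have hu1 : ContDiff ℝ 1 (deriv u) := by have := hu.iterate_deriv' 1 1; simpa using this
  have hdu1 : Differentiable ℝ (deriv u) := hu1.differentiable (by simp)
  have hcw := hw.continuous
  have hcw' : Continuous (deriv w) := hw.continuous_deriv le_rfl
  have hcu' : Continuous (deriv u) := hu1.continuous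
  have hcu'' : Continuous (deriv (deriv u)) := hu1.continuous_deriv le_rfl
  have hder : ∀ θ ∈ Set.uIcc (0 : ℝ) (π / 2), HasDerivAt (fun θ => w θ * deriv u θ)
      (deriv w θ * deriv u θ + w θ * deriv (deriv u) θ) θ := fun θ _ =>
    (hdw θ).hasDerivAt.mul (hdu1 θ).hasDerivAt
  have hFTC := integral_eq_sub_of_hasDerivAt hder ((by fun_prop : Continuous fun θ =>
    deriv w θ * deriv u θ + w θ * deriv (deriv u) θ).intervalIntegrable _ _)
  simp only [hw0, hw1, zero_mul, sub_zero] at hFTC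
  have i1 : IntervalIntegrable (fun θ => deriv w θ * deriv u θ) volume 0 (π / 2) := (hcw'.mul hcu').intervalIntegrable _ _
  have i2 : IntervalIntegrable (fun θ => w θ * deriv (deriv u) θ) volume 0 (π / 2) := (hcw.mul hcu'').intervalIntegrable _ _
  rw [intervalIntegral.integral_add i1 i2] at hFTC
  linarith

/-- **The `tan`-multiplier identity**: for `χ ∈ C²(ℝ)` with `χ(0) = 0`,
`∫₀^{π/2}(cosθχ + sinθχ′)(cosθχ + 2sinθχ′ − cosθχ″)dθ = (3/2)∫₀^{π/2}χ′² + ½∫₀^{π/2}χ²`. [cite: Elgindi2021, §7.1 proof of Proposition 7.1 Step 2, the computation of −∫∂_θ(tanθΨ)∂_θθΨ (p. 20 of arXiv:1904.04795)] -/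
theorem integral_tanTerm_mul_deriv2 {χ : ℝ → ℝ} (hχ : ContDiff ℝ 2 χ) (h0 : χ 0 = 0) :
    ∫ θ in (0 : ℝ)..(π / 2), (Real.cos θ * χ θ + Real.sin θ * deriv χ θ) *
        (Real.cos θ * χ θ + 2 * Real.sin θ * deriv χ θ - Real.cos θ * deriv (deriv χ) θ) =
      (3 / 2) * (∫ θ in (0 : ℝ)..(π / 2), deriv χ θ ^ 2) + (1 / 2) * ∫ θ in (0 : ℝ)..(π / 2), χ θ ^ 2 := by
  have hd : Differentiable ℝ χ := hχ.differentiable (by simp)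
  have hχ1 : ContDiff ℝ 1 (deriv χ) := by have := hχ.iterate_deriv' 1 1; simpa using this
  have hd1 : Differentiable ℝ (deriv χ) := hχ1.differentiable (by simp)
  have hc0 := hχ.continuous
  have hc1 := hχ1.continuous
  have hc2 : Continuous (deriv (deriv χ)) := hχ1.continuous_deriv le_rfl
  -- the antiderivative `H = ½ sin cos χ² − cos² χ χ' − ½ sin cos χ'²`
  set H : ℝ → ℝ := fun θ => (1 / 2) * ((Real.sin θ * Real.cos θ) * χ θ ^ 2) - Real.cos θ ^ 2 * (χ θ * deriv χ θ) -
    (1 / 2) * ((Real.sin θ * Real.cos θ) * deriv χ θ ^ 2) with hH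
  set H' : ℝ → ℝ := fun θ => (1 / 2) * (Real.cos θ ^ 2 - Real.sin θ ^ 2) * χ θ ^ 2 +
    3 * Real.sin θ * Real.cos θ * χ θ * deriv χ θ - Real.cos θ ^ 2 * deriv χ θ ^ 2 -
    Real.cos θ ^ 2 * χ θ * deriv (deriv χ) θ - (1 / 2) * (Real.cos θ ^ 2 - Real.sin θ ^ 2) * deriv χ θ ^ 2 -
    Real.sin θ * Real.cos θ * deriv χ θ * deriv (deriv χ) θ with hH'
  have hder : ∀ θ ∈ Set.uIcc (0 : ℝ) (π / 2), HasDerivAt H (H' θ) θ := by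
    intro θ _
    have hs := Real.hasDerivAt_sin θ
    have hc := Real.hasDerivAt_cos θ
    have hsc : HasDerivAt (fun θ => Real.sin θ * Real.cos θ) (Real.cos θ * Real.cos θ + Real.sin θ * -Real.sin θ) θ := hs.mul hc
    have hc2' : HasDerivAt (fun θ => Real.cos θ ^ 2) (2 * Real.cos θ * -Real.sin θ) θ := by
      have e : (fun θ => Real.cos θ ^ 2) = fun θ => Real.cos θ * Real.cos θ := by funext θ; ring
      rw [e]; exact (hc.mul hc).congr_deriv (by ring)
    have hx : HasDerivAt χ (deriv χ θ) θ := (hd θ).hasDerivAt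
    have hx' : HasDerivAt (deriv χ) (deriv (deriv χ) θ) θ := (hd1 θ).hasDerivAt
    have hx2 : HasDerivAt (fun θ => χ θ ^ 2) (2 * χ θ * deriv χ θ) θ := by
      have e : (fun θ => χ θ ^ 2) = fun θ => χ θ * χ θ := by funext θ; ring
      rw [e]; exact (hx.mul hx).congr_deriv (by ring)
    have hx'2 : HasDerivAt (fun θ => deriv χ θ ^ 2) (2 * deriv χ θ * deriv (deriv χ) θ) θ := by
      have e : (fun θ => deriv χ θ ^ 2) = fun θ => deriv χ θ * deriv χ θ := by funext θ; ring
      rw [e]; exact (hx'.mul hx').congr_deriv (by ring)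
    have hxx' : HasDerivAt (fun θ => χ θ * deriv χ θ) (deriv χ θ * deriv χ θ + χ θ * deriv (deriv χ) θ) θ := hx.mul hx'
    have h := (((hsc.mul hx2).const_mul (1 / 2)).sub (hc2'.mul hxx')).sub ((hsc.mul hx'2).const_mul (1 / 2))
    refine h.congr_deriv ?_
    simp only [hH']
    ring
  have hcH' : Continuous H' := by simp only [hH']; fun_prop
  have hFTC := integral_eq_sub_of_hasDerivAt hder (hcH'.intervalIntegrable _ _)
  have hHb : H (π / 2) - H 0 = 0 := by simp [hH, h0]
  rw [hHb] at hFTC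
  -- pointwise: integrand = (3/2)χ'² + ½χ² + H'  (mod sin² + cos² = 1)
  have e : ∀ θ, (Real.cos θ * χ θ + Real.sin θ * deriv χ θ) *
      (Real.cos θ * χ θ + 2 * Real.sin θ * deriv χ θ - Real.cos θ * deriv (deriv χ) θ) =
      ((3 / 2) * deriv χ θ ^ 2 + (1 / 2) * χ θ ^ 2) + H' θ := by
    intro θ
    simp only [hH']
    have := Real.sin_sq_add_cos_sq θ
    linear_combination ((1 / 2) * χ θ ^ 2 + (3 / 2) * deriv χ θ ^ 2) * this
  simp_rw [e]
  have i1 : IntervalIntegrable (fun θ => (3 / 2) * deriv χ θ ^ 2 + (1 / 2) * χ θ ^ 2) volume 0 (π / 2) :=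
    (by fun_prop : Continuous fun θ => (3 / 2) * deriv χ θ ^ 2 + (1 / 2) * χ θ ^ 2).intervalIntegrable _ _
  have i2 : IntervalIntegrable H' volume 0 (π / 2) := hcH'.intervalIntegrable _ _
  have i3 : IntervalIntegrable (fun θ => (3 / 2) * deriv χ θ ^ 2) volume 0 (π / 2) := ((hc1.pow 2).const_mul _).intervalIntegrable _ _
  have i4 : IntervalIntegrable (fun θ => (1 / 2) * χ θ ^ 2) volume 0 (π / 2) := ((hc0.pow 2).const_mul _).intervalIntegrable _ _
  rw [intervalIntegral.integral_add i1 i2, hFTC, intervalIntegral.integral_add i3 i4,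
    intervalIntegral.integral_const_mul, intervalIntegral.integral_const_mul]
  ring

end Elgindi

end Literature.Analysis.FluidPDE
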